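import Summits.AtomisticToContinuum.FouriersLaw.Theorems.OddSectorIrreversibilityTapLeakBoundMassiveTap

/-!
# `TapLeakBound` (stmt-AtomisticToContinuum-15159), line `SketchIdeator2`: the overdamped resolvent calculus

Helper file (`--supports stmt-AtomisticToContinuum-15159`) for crux P =
`Summit.AtomisticToContinuum.FouriersLaw.Theses.OddSectorIrreversibility.TapLeakBound` (route
`OddSectorIrreversibility`, sub-problem `FouriersLaw`), registered stub `stub_mixedTap` (= `MixedTapBound`, the
corrector-side `N`-uniform bet of the line; idea card drain-convexity-second-tap-identity). This file holds the two
EXACT fixed-`N` lemmas of the card's overdamped route (its typed `OverdampedResolventIdentity` and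
`ResolventContraction`), kernel-checked; the reduction of the stub to its `N`-uniform residuals is in
`…TapLeakBoundMixedTap.lean`.

* `partialQ_generator` — **`∂_{q_b}` through the equal-temperature generator** `L = X_H + γ S_B`
  (`generator_eq_liouvilleOp_add`): `∂_{q_b}(L u) = L(∂_{q_b} u) − Σ_i (∂_{q_b}∂_{q_i}H) ∂_{p_i} u` for `u ∈ C³`
  (`[∂_{q_b}, X_H] = −Σ_i H_{q_bq_i}∂_{p_i}` by `hasDerivAt_liouvilleOp_positionLine`, `[∂_{q_b}, S_B] = 0` by
  `hasDerivAt_bathOp_positionLine`; Schwarz `partialQ_partialQ_comm`, `partialP_partialQ_comm`). Companion of the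
  landed `partialP_generator` (`∂_{p_b}(L u) = L(∂_{p_b}u) + ∂_{q_b}u − γB_b∂_{p_b}u`, …TapLeakBoundMassiveTap).
* `generator_overdamped_of_poisson` — **the overdamped resolvent identity** (pointwise): for a `C³` solution of
  `L u = −J` and `c γ B_b = 1` (`B = bathWeight`), `w = ∂_{p_b}u − c ∂_{q_b}u` (the momentum derivative at fixed
  overdamped contact coordinate `q_b + p_b/(γB_b)`) solves `(γB_b − L) w = F`,
  `F = ∂_{p_b}J − c∂_{q_b}J + c Σ_i (∂_{q_b}∂_{q_i}H) ∂_{p_i}u`: the contact friction puts the spectral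
  parameter `γ B_b > 0` on the left.
* `resolvent_contraction` — **`(κ − L)⁻¹` contracts by `1/κ` on `L²(μ_T)`** for classical solutions
  (`w ∈ C² ∩ L²`, `F ∈ C⁰ ∩ L²`, `L w = κw − F` ⟹ `κ‖w‖² ≤ ⟨w,F⟩`, `κ²‖w‖² ≤ ‖F‖²`), at EVERY `N` with the same
  constant: dissipativity via the landed tap energy identity `integral_mul_source_eq_dirichlet`; no gap, no rate.

References: folklore (Villani, Hypocoercivity §A.19–A.21 for the commutator bookkeeping; Eckmann–Pillet–Rey-Bellet
1999 §3 for the Dirichlet form). Nothing here closes the item.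
-/

noncomputable section

open MeasureTheory ProbabilityTheory Filter Topology Set Function
open scoped NNReal ENNReal ContDiff

namespace Summit.AtomisticToContinuum.FouriersLaw.Theorems.OddSectorIrreversibility.TapLeak

open Literature.MathematicalPhysics.KineticTheory.HeatConduction
open Literature.MathematicalPhysics.KineticTheory
open Summit.AtomisticToContinuum.FouriersLaw.Theorems.OddSectorWitness
open Summit.AtomisticToContinuum.FouriersLaw.Theorems.OddSectorIrreversibility.Corrector
open Summit.AtomisticToContinuum.FouriersLaw.Theorems.SuperadditiveResistance.DeviceLiouville

/-! ### Pointwise calculus: `∂_{q_b}` through the generator -/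

section Calculus

variable {N : ℕ}

/-- Schwarz in two positions: `∂_{q_i} ∂_{q_j} f = ∂_{q_j} ∂_{q_i} f` for `f ∈ C²`. [folklore] -/
theorem partialQ_partialQ_comm {f : PhaseSpace N → ℝ} (hf : ContDiff ℝ 2 f) (i j : Fin N)
    (x : PhaseSpace N) : partialQ i (partialQ j f) x = partialQ j (partialQ i f) x := by
  -- adapted from `partialP_partialP_comm` (…TapLeakBoundMassiveTap)
  have hfd : Differentiable ℝ f := hf.differentiable two_ne_zero
  have hQ : ∀ k : Fin N, partialQ k f = fun y => fderiv ℝ f y ((Pi.single k 1, 0) : PhaseSpace N) :=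
    fun k => partialQ_eq_fderiv hfd k
  have hdQ : ∀ k : Fin N, Differentiable ℝ (partialQ k f) := fun k => by
    rw [hQ k]; exact fun y => (hasFDerivAt_fderiv_apply hf y _).differentiableAt
  rw [partialQ_eq_fderiv (hdQ j), partialQ_eq_fderiv (hdQ i)]
  simp only [hQ]
  rw [(hasFDerivAt_fderiv_apply hf x _).fderiv, (hasFDerivAt_fderiv_apply hf x _).fderiv]
  simp only [ContinuousLinearMap.flip_apply]
  exact fderiv_fderiv_symm hf x _ _

/-- `∂_{q_b}(-f) = -∂_{q_b} f` (unconditionally). [folklore] -/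
theorem partialQ_neg_apply (b : Fin N) (f : PhaseSpace N → ℝ) (x : PhaseSpace N) :
    partialQ b (fun y => -f y) x = -partialQ b f x := by
  unfold partialQ
  rw [← deriv.neg]
  rfl

/-- A differentiable `G` restricted to the `q_b`-line through `x` has derivative `∂_{q_b} G (x)` at the
base point. [folklore] -/
theorem hasDerivAt_positionLine {G : PhaseSpace N → ℝ} (hG : Differentiable ℝ G) (b : Fin N)
    (x : PhaseSpace N) :
    HasDerivAt (fun s => G (Function.update x.1 b s, x.2)) (partialQ b G x) (x.1 b) := by
  have hl : Differentiable ℝ (fun s : ℝ => ((Function.update x.1 b s, x.2) : PhaseSpace N)) :=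
    fun s => ((hasDerivAt_update x.1 b s).prodMk (hasDerivAt_const s x.2)).differentiableAt
  exact ((hG.comp hl) (x.1 b)).hasDerivAt

/-- **`∂_{q_b}` through the Liouville operator** (`u ∈ C²`, `C³` potentials): along the `q_b`-line,
`X_H u` has derivative `X_H(∂_{q_b} u) − Σ_i (∂_{q_b}∂_{q_i}H) ∂_{p_i} u` — the commutator
`[∂_{q_b}, X_H] = −Σ_i H_{q_b q_i} ∂_{p_i}` (`∂_{q_b} p_i = 0`, Schwarz). [folklore] -/
theorem hasDerivAt_liouvilleOp_positionLine (P : OscillatorChain) (hU : ContDiff ℝ 3 P.U)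
    (hV : ContDiff ℝ 3 P.V) {u : PhaseSpace N → ℝ} (hu : ContDiff ℝ 2 u) (b : Fin N)
    (x : PhaseSpace N) :
    HasDerivAt (fun s => liouvilleOp P N u (Function.update x.1 b s, x.2))
      (liouvilleOp P N (partialQ b u) x -
        ∑ i, partialQ b (partialQ i (P.hamiltonian N)) x * partialP i u x) (x.1 b) := by
  have hQd : ∀ i, Differentiable ℝ (partialQ i u) := fun i =>
    (HeatConduction.contDiff_partialQ hu (m := 1) (by norm_num) i).differentiable one_ne_zero
  have hPd : ∀ i, Differentiable ℝ (partialP i u) := fun i =>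
    (contDiff_partialP hu (m := 1) (by norm_num) i).differentiable one_ne_zero
  have hH : ContDiff ℝ 3 (P.hamiltonian N) := P.contDiff_hamiltonian hU hV N
  have hHQd : ∀ i, Differentiable ℝ (partialQ i (P.hamiltonian N)) := fun i =>
    (HeatConduction.contDiff_partialQ hH (m := 2) (by norm_num) i).differentiable two_ne_zero
  have hsum : HasDerivAt (fun s => liouvilleOp P N u (Function.update x.1 b s, x.2))
      (∑ i, (x.2 i * partialQ b (partialQ i u) x -
        (partialQ b (partialQ i (P.hamiltonian N)) x * partialP i u x +
          partialQ i (P.hamiltonian N) x * partialQ b (partialP i u) x))) (x.1 b) := by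
    unfold liouvilleOp
    refine HasDerivAt.fun_sum fun i _ => ?_
    refine (((hasDerivAt_positionLine (hQd i) b x).const_mul (x.2 i)).fun_sub
      ((hasDerivAt_positionLine (hHQd i) b x).fun_mul (hasDerivAt_positionLine (hPd i) b x))).congr_deriv ?_
    simp only [Function.update_eq_self, Prod.mk.eta]
  refine hsum.congr_deriv ?_
  have e2 : ∀ i ∈ (Finset.univ : Finset (Fin N)),
      (x.2 i * partialQ b (partialQ i u) x -
        (partialQ b (partialQ i (P.hamiltonian N)) x * partialP i u x +
          partialQ i (P.hamiltonian N) x * partialQ b (partialP i u) x)) =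
      (x.2 i * partialQ i (partialQ b u) x - partialQ i (P.hamiltonian N) x * partialP i (partialQ b u) x) -
        partialQ b (partialQ i (P.hamiltonian N)) x * partialP i u x := by
    intro i _
    rw [partialQ_partialQ_comm hu b i x, ← partialP_partialQ_comm hu i b x]
    ring
  rw [Finset.sum_congr rfl e2, Finset.sum_sub_distrib]
  rfl

/-- **`∂_{q_b}` through the thermostat** (`u ∈ C³`): along the `q_b`-line, `S_B u` has derivative
`S_B(∂_{q_b} u)` — `∂_{q_b}` commutes with `S_B` (Schwarz twice). [folklore] -/
theorem hasDerivAt_bathOp_positionLine {u : PhaseSpace N → ℝ} (hu : ContDiff ℝ 3 u) (B : Fin N → ℝ)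
    (T : ℝ) (b : Fin N) (x : PhaseSpace N) :
    HasDerivAt (fun s => bathOp N B T u (Function.update x.1 b s, x.2))
      (bathOp N B T (partialQ b u) x) (x.1 b) := by
  have hu2 : ContDiff ℝ 2 u := hu.of_le (by norm_num)
  have hP2 : ∀ i, ContDiff ℝ 2 (partialP i u) := fun i => contDiff_partialP hu (m := 2) (by norm_num) i
  have hPd : ∀ i, Differentiable ℝ (partialP i u) := fun i => (hP2 i).differentiable two_ne_zero
  have hPPd : ∀ i, Differentiable ℝ (partialP i (partialP i u)) := fun i =>
    (contDiff_partialP (hP2 i) (m := 1) (by norm_num) i).differentiable one_ne_zero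
  -- third-order Schwarz: `∂_{q_b} ∂_{p_i} ∂_{p_i} u = ∂_{p_i} ∂_{p_i} ∂_{q_b} u`
  have h3 : ∀ i, partialQ b (partialP i (partialP i u)) x = partialP i (partialP i (partialQ b u)) x :=
    fun i => by
    rw [← partialP_partialQ_comm (hP2 i) i b x]
    have e : partialQ b (partialP i u) = partialP i (partialQ b u) :=
      funext fun y => (partialP_partialQ_comm hu2 i b y).symm
    rw [e]
  have hsum : HasDerivAt (fun s => bathOp N B T u (Function.update x.1 b s, x.2))
      (∑ i, B i * (T * partialQ b (partialP i (partialP i u)) x -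
        x.2 i * partialQ b (partialP i u) x)) (x.1 b) := by
    unfold bathOp
    refine HasDerivAt.fun_sum fun i _ => ?_
    exact (((hasDerivAt_positionLine (hPPd i) b x).const_mul T).fun_sub
      ((hasDerivAt_positionLine (hPd i) b x).const_mul (x.2 i))).const_mul (B i)
  refine hsum.congr_deriv ?_
  have e2 : ∀ i ∈ (Finset.univ : Finset (Fin N)),
      B i * (T * partialQ b (partialP i (partialP i u)) x - x.2 i * partialQ b (partialP i u) x) =
      B i * (T * partialP i (partialP i (partialQ b u)) x - x.2 i * partialP i (partialQ b u) x) := by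
    intro i _
    rw [h3 i, ← partialP_partialQ_comm hu2 i b x]
  rw [Finset.sum_congr rfl e2]
  rfl

/-- **`∂_{q_b}` through the equal-temperature generator** (`u ∈ C³`, `C³` potentials):
`∂_{q_b}(L u) = L(∂_{q_b} u) − Σ_i (∂_{q_b}∂_{q_i}H) ∂_{p_i} u`. [folklore] -/
theorem partialQ_generator (P : OscillatorChain) (hU : ContDiff ℝ 3 P.U) (hV : ContDiff ℝ 3 P.V)
    {u : PhaseSpace N → ℝ} (hu : ContDiff ℝ 3 u) (T : ℝ) (b : Fin N) (x : PhaseSpace N) :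
    partialQ b (P.generator N T T u) x =
      P.generator N T T (partialQ b u) x -
        ∑ i, partialQ b (partialQ i (P.hamiltonian N)) x * partialP i u x := by
  have hu2 : ContDiff ℝ 2 u := hu.of_le (by norm_num)
  have eG : (fun s => P.generator N T T u (Function.update x.1 b s, x.2)) = fun s =>
      liouvilleOp P N u (Function.update x.1 b s, x.2) +
        P.γ * bathOp N (OscillatorChain.bathWeight N) T u (Function.update x.1 b s, x.2) :=
    funext fun s => generator_eq_liouvilleOp_add P N T u _
  have h : HasDerivAt (fun s => P.generator N T T u (Function.update x.1 b s, x.2))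
      (liouvilleOp P N (partialQ b u) x -
          ∑ i, partialQ b (partialQ i (P.hamiltonian N)) x * partialP i u x +
        P.γ * bathOp N (OscillatorChain.bathWeight N) T (partialQ b u) x) (x.1 b) := by
    rw [eG]
    exact (hasDerivAt_liouvilleOp_positionLine P hU hV hu2 b x).fun_add
      ((hasDerivAt_bathOp_positionLine hu _ T b x).const_mul P.γ)
  have e1 : partialQ b (P.generator N T T u) x = _ := h.deriv
  rw [e1, generator_eq_liouvilleOp_add P N T (partialQ b u) x]
  ring

/-- The generator is linear on the overdamped combination: for `u ∈ C³`,
`L(∂_{p_b} u − c ∂_{q_b} u) = L(∂_{p_b} u) − c L(∂_{q_b} u)`. [folklore] -/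
theorem generator_overdamped (P : OscillatorChain) {u : PhaseSpace N → ℝ} (hu : ContDiff ℝ 3 u)
    (T c : ℝ) (b : Fin N) (x : PhaseSpace N) :
    P.generator N T T (fun y => partialP b u y - c * partialQ b u y) x =
      P.generator N T T (partialP b u) x - c * P.generator N T T (partialQ b u) x := by
  have hP2 : ContDiff ℝ 2 (partialP b u) := contDiff_partialP hu (m := 2) (by norm_num) b
  have hQ2 : ContDiff ℝ 2 (partialQ b u) := HeatConduction.contDiff_partialQ hu (m := 2) (by norm_num) b
  have hcQ2 : ContDiff ℝ 2 (fun y => c * partialQ b u y) := contDiff_const.mul hQ2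
  rw [generator_eq_liouvilleOp_add, generator_eq_liouvilleOp_add, generator_eq_liouvilleOp_add,
    liouvilleOp_sub (hP2.differentiable two_ne_zero) (hcQ2.differentiable two_ne_zero),
    bathOp_sub hP2 hcQ2, Corrector.liouvilleOp_const_mul, Corrector.bathOp_const_mul]
  ring

/-- **The overdamped resolvent identity (pointwise).** For a `C³` classical solution of `L u = −J`
(`J` differentiable, `C³` potentials) and `c` with `c · γ B_b = 1` (`B = bathWeight`), the overdamped
contact derivative `w = ∂_{p_b} u − c ∂_{q_b} u` solves
`L w = −(F − γ B_b w)`, `F = (∂_{p_b} J − c ∂_{q_b} J) + c Σ_i (∂_{q_b}∂_{q_i}H) ∂_{p_i} u`,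
i.e. `(γ B_b − L) w = F`. [folklore] -/
theorem generator_overdamped_of_poisson (P : OscillatorChain) (hU : ContDiff ℝ 3 P.U)
    (hV : ContDiff ℝ 3 P.V) {u J : PhaseSpace N → ℝ} (hu : ContDiff ℝ 3 u) (T : ℝ) (b : Fin N)
    {c : ℝ} (hc : c * (P.γ * OscillatorChain.bathWeight N b) = 1)
    (hpde : ∀ x, P.generator N T T u x = -J x) (x : PhaseSpace N) :
    P.generator N T T (fun y => partialP b u y - c * partialQ b u y) x =
      -((partialP b J x - c * partialQ b J x +
          c * ∑ i, partialQ b (partialQ i (P.hamiltonian N)) x * partialP i u x) -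
        P.γ * OscillatorChain.bathWeight N b * (partialP b u x - c * partialQ b u x)) := by
  have hU2 : ContDiff ℝ 2 P.U := hU.of_le (by norm_num)
  have hV2 : ContDiff ℝ 2 P.V := hV.of_le (by norm_num)
  have eLu : P.generator N T T u = fun y => -J y := funext hpde
  have h1 := partialP_generator P hU2 hV2 hu T b x
  have h2 := partialQ_generator P hU hV hu T b x
  rw [eLu, partialP_neg_apply] at h1
  rw [eLu, partialQ_neg_apply] at h2
  rw [generator_overdamped P hu T c b x]
  have h3 : c * (P.γ * OscillatorChain.bathWeight N b) * partialQ b u x = partialQ b u x := by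
    rw [hc, one_mul]
  linear_combination -h1 + c * h2 + h3

end Calculus

/-! ### The resolvent contraction at fixed `N` (valid at every `N`) -/

section Contraction

variable {ω₂ lam β γ : ℝ} (hω : 0 < ω₂) (hl : 0 ≤ lam) (hβ : 0 ≤ β) (hγ : 0 < γ) {T : ℝ} (hT : 0 < T)
  {N : ℕ}

include hω hl hβ hγ hT

/-- **Resolvent contraction** (dissipativity of `L` in `L²(μ_T)`, fixed `N`, valid at EVERY `N` with the
same constant): if `w ∈ C² ∩ L²(μ_T)`, `F ∈ C⁰ ∩ L²(μ_T)` and `L_{T,T} w = κ w − F` pointwise, then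
`κ ‖w‖² ≤ ⟨w, F⟩` and `κ² ‖w‖² ≤ ‖F‖²` in `L²(μ_T)` (`μ_T` the unnormalised Gibbs weight): the tap energy
identity `integral_mul_source_eq_dirichlet` for the pair `(w, F − κ w)` says `⟨w, F − κ w⟩ = γTΣ_i B_i‖∂_{p_i}w‖² ≥ 0`,
and `wF ≤ (κw² + F²/κ)/2` pointwise. No spectral gap is used. [folklore] -/
theorem resolvent_contraction {κ : ℝ} (hκ : 0 < κ) {w F : PhaseSpace N → ℝ} (hw : ContDiff ℝ 2 w)
    (hw2 : MemLp w 2 (gibbsWeight ω₂ lam β γ N T)) (hFc : Continuous F)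
    (hF2 : MemLp F 2 (gibbsWeight ω₂ lam β γ N T))
    (hpde : ∀ x, (pinnedChain ω₂ lam β γ).generator N T T w x = -(F x - κ * w x)) :
    κ * ∫ x, (w x) ^ 2 ∂(gibbsWeight ω₂ lam β γ N T) ≤ ∫ x, w x * F x ∂(gibbsWeight ω₂ lam β γ N T) ∧
    κ ^ 2 * ∫ x, (w x) ^ 2 ∂(gibbsWeight ω₂ lam β γ N T) ≤ ∫ x, (F x) ^ 2 ∂(gibbsWeight ω₂ lam β γ N T) := by
  set P := pinnedChain ω₂ lam β γ with hP
  set μ := gibbsWeight ω₂ lam β γ N T with hμ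
  haveI : IsFiniteMeasure μ := isFiniteMeasure_gibbsWeight hω hl hβ γ N hT
  have hw2π : MemLp w 2 (P.gibbsMeasure N T) := memLp_gibbsMeasure_of_gibbsWeight hω hl hβ γ N hT hw2
  have hF2π : MemLp F 2 (P.gibbsMeasure N T) := memLp_gibbsMeasure_of_gibbsWeight hω hl hβ γ N hT hF2
  have hkc : Continuous fun x => F x - κ * w x := hFc.sub (continuous_const.mul hw.continuous)
  have hk2π : MemLp (fun x => F x - κ * w x) 2 (P.gibbsMeasure N T) := hF2π.sub (hw2π.const_mul κ)
  have hD := integral_mul_source_eq_dirichlet hω hl hβ hγ hT hw hw2π hkc hk2π hpde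
  have hρ : ∀ f : PhaseSpace N → ℝ, ∫ x, f x ∂μ = ∫ x, f x * P.gibbsDensity N T x := fun f =>
    gaussIBP_integral_gibbsWeight ω₂ lam β γ N T f
  have hD' : ∫ x, w x * (F x - κ * w x) ∂μ =
      γ * T * ∑ i, OscillatorChain.bathWeight N i * ∫ x, partialP i w x ^ 2 ∂μ := by
    rw [hρ]
    simp only [hρ]
    exact hD
  have hpos : 0 ≤ ∫ x, w x * (F x - κ * w x) ∂μ := by
    rw [hD']
    refine mul_nonneg (mul_nonneg hγ.le hT.le) (Finset.sum_nonneg fun i _ => ?_)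
    exact mul_nonneg (Corrector.bathWeight_nonneg N i) (integral_nonneg fun x => sq_nonneg _)
  have hIwF : Integrable (fun x => w x * F x) μ := hw2.integrable_mul hF2
  have hIww : Integrable (fun x => (w x) ^ 2) μ := hw2.integrable_sq
  have hIFF : Integrable (fun x => (F x) ^ 2) μ := hF2.integrable_sq
  have hsplit : ∫ x, w x * (F x - κ * w x) ∂μ = (∫ x, w x * F x ∂μ) - κ * ∫ x, (w x) ^ 2 ∂μ := by
    rw [← integral_const_mul, ← integral_sub hIwF (hIww.const_mul κ)]
    exact integral_congr_ae (Eventually.of_forall fun x => by ring)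
  have h1 : κ * ∫ x, (w x) ^ 2 ∂μ ≤ ∫ x, w x * F x ∂μ := by linarith
  refine ⟨h1, ?_⟩
  -- `wF ≤ (κ w² + F²/κ)/2` pointwise
  have ham : ∫ x, w x * F x ∂μ ≤ ∫ x, (κ / 2 * (w x) ^ 2 + 1 / (2 * κ) * (F x) ^ 2) ∂μ := by
    refine integral_mono hIwF ((hIww.const_mul _).add (hIFF.const_mul _)) fun x => ?_
    have h := sq_nonneg (κ * w x - F x)
    have e : κ / 2 * (w x) ^ 2 + 1 / (2 * κ) * (F x) ^ 2 - w x * F x = (κ * w x - F x) ^ 2 / (2 * κ) := by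
      field_simp
      ring
    have : 0 ≤ (κ * w x - F x) ^ 2 / (2 * κ) := by positivity
    linarith
  rw [integral_add (hIww.const_mul _) (hIFF.const_mul _), integral_const_mul, integral_const_mul] at ham
  generalize hW : ∫ x, (w x) ^ 2 ∂μ = W at h1 ham ⊢
  generalize hΦ : ∫ x, (F x) ^ 2 ∂μ = Φ at ham ⊢
  have h2 : κ * W ≤ κ / 2 * W + 1 / (2 * κ) * Φ := h1.trans ham
  have h3 : κ / 2 * W ≤ 1 / (2 * κ) * Φ := by linarith
  have h4 := mul_le_mul_of_nonneg_left h3 (show (0 : ℝ) ≤ 2 * κ by positivity)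
  have e1 : 2 * κ * (κ / 2 * W) = κ ^ 2 * W := by ring
  have e2 : 2 * κ * (1 / (2 * κ) * Φ) = Φ := by field_simp
  linarith [h4, e1, e2]

end Contraction

/-- **Registered sub-goal `stub_resolventContraction` of line `SketchIdeator2`** (= `resolvent_contraction` with its
parameters explicit; the card's typed `ResolventContraction` for classical `C² ∩ L²` solutions, no growth class
needed): `L_{T,T} w = κ w − F` pointwise ⟹ `κ‖w‖² ≤ ⟨w, F⟩` and `κ²‖w‖² ≤ ‖F‖²` in `L²(μ_T)`, at every `N`.
[folklore] -/
theorem stub_resolventContraction : ∀ {ω₂ lam β γ : ℝ}, 0 < ω₂ → 0 ≤ lam → 0 ≤ β → 0 < γ → ∀ {T : ℝ}, 0 < T →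
    ∀ {N : ℕ} {κ : ℝ}, 0 < κ → ∀ {w F : PhaseSpace N → ℝ}, ContDiff ℝ 2 w →
    MemLp w 2 (gibbsWeight ω₂ lam β γ N T) → Continuous F → MemLp F 2 (gibbsWeight ω₂ lam β γ N T) →
    (∀ x, (pinnedChain ω₂ lam β γ).generator N T T w x = -(F x - κ * w x)) →
    κ * ∫ x, (w x) ^ 2 ∂(gibbsWeight ω₂ lam β γ N T) ≤ ∫ x, w x * F x ∂(gibbsWeight ω₂ lam β γ N T) ∧
    κ ^ 2 * ∫ x, (w x) ^ 2 ∂(gibbsWeight ω₂ lam β γ N T) ≤ ∫ x, (F x) ^ 2 ∂(gibbsWeight ω₂ lam β γ N T) := by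
  intro ω₂ lam β γ hω hl hβ hγ T hT N κ hκ w F hw hw2 hFc hF2 hpde
  exact resolvent_contraction hω hl hβ hγ hT hκ hw hw2 hFc hF2 hpde

end Summit.AtomisticToContinuum.FouriersLaw.Theorems.OddSectorIrreversibility.TapLeak

end
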